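import Summits.BirchSwinnertonDyer.BirchSwinnertonDyer.Theorems.ErratumRoadFiveOpenInputRamOffErratumLocusReduction
import Summits.BirchSwinnertonDyer.BirchSwinnertonDyer.Theorems.ErratumRoadFiveControlFromJSWMult
import HarnessLib

/-!
# Route `ErratumRoadFive`, child crux `OpenInputRamOffErratumLocus` (item stmt-BirchSwinnertonDyer-19274)
# of `OpenInputIMC` (19061): the (ram) residual WITHOUT semistability and WITHOUT the Locus — the
# erratum road reaches EVERY pair with an odd non-split (ram) witness and `E(ℚ_p)[p] = 0`, modulo the
# sibling children H3♭ (19270), H2 (19275), the facts (19283), Wuthrich 2014 Prop. 21 and the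
# Jetchev–Skinner–Wan control theorem at a multiplicative `p` (file 4 of seat imc-p1; session g3)

Cell `bsd-stepL` (run/shared/lean/pub/bsd-stepL/), seat `bsd-stepL-imc-p1` (prover; D-0074 row A),
session g3; `--supports stmt-BirchSwinnertonDyer-19274`. HONEST FRAMING: nothing here proves the
child or the crux; BSD is not proved by any of this; the sibling children `IMCDivAtErratumDataAll`
(H3♭ at every pair, ⇐ [FW21, Thm. 4.41] via Castella's erratum Thm. 1.1, PREPRINT) and
`BDPValueCoreFramesAll` (H2 at every pair, cell memo THEOREM C♯) are OPEN route items taken as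
HYPOTHESES, and every published ∕ cited named fact is a hypothesis. THEOREMS ONLY; pure composition
of files 1–3 of this seat (`ErratumRoadFiveOpenInputIMCOneSided`, p422211;
`ErratumRoadFiveOpenInputIMCNoSecondPrime`, p424576; `ErratumRoadFiveOpenInputRamOffErratumLocusReduction`,
p431853) with the typer's `ErratumRoadFiveControlFromJSWMult` (p432484: `P2ControlOnTreeAt W p` at
EVERY pair from `JetchevSkinnerWan2017.thm331_anticyclotomicControl_mult`, PUBLISHED, p428223).

## What this file proves

File 3 reduced child 19274 to REST″ = the open input on the (ram) pairs with NO odd non-split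
`E[p]`-ramified multiplicative `q ≠ p` inside (Locus ∪ (Semistable ∧ (iv))); the conjunct
`Semistable W` came ONLY from the control theorem entering as Cas18 Thm. 2.3
(`Castella2018.thm23_anticyclotomicControl`, Castella's standing hypothesis "E semistable"). With the
control identity now available at every pair (JSW17 Thm. 3.3.1 + (3.5.c) at a multiplicative `p`,
any conductor), the semistability conjunct and the Locus disjunct both disappear:

* §1 **`openInputOnTreeAt_of_oddNonsplitRam_of_localTorsion_of_coreFrames`** — pair level, ANY
  conductor, on or off the Locus: an odd non-split multiplicative `q ≠ p` with `p ∤ v_q(Δ_min)` and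
  (iv) `E(ℚ_p)[p] = 0`, H2 ∧ H3♭ (the siblings pointwise) + the published facts ⟹
  `P2OpenInputOnTreeAt W p`. (On the Locus `p ∤ ∏c`, (iv) is a theorem:
  `LocalTorsion.localTorsion_eq_zero_of_not_dvd_tamagawaProduct`; §1b records that corollary.)
* §2 **`openInputRamOffErratumLocus_of_children_of_rest3`** — `IMCDivAtErratumDataAll` (19270) →
  `BDPValueCoreFramesAll` (19275) → `PublishedInputsIMCReduction` (19283) → `sha_dvd_analyticSha`
  (Wuthrich 2014 Prop. 21; = support item 19285 by `rfl`) → `thm331_anticyclotomicControl_mult`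
  (JSW17, PUBLISHED) → REST‴ → `OpenInputRamOffErratumLocus`, where
  **REST‴** := `∀ W p, Ram W p → ¬ ((∃ q prime, q ≠ 2 ∧ q ≠ p ∧ Mult W q ∧ ¬Split W q ∧ p ∤ v_q(Δ_min))
  ∧ (∀ P ∈ E(ℚ_p), p • P = 0 → P = 0)) → P2OpenInputOnTreeAt W p`.
* §3 Bookkeeping for the planner: `rest3_of_rest2` (REST″ ⟹ REST‴: the new residual hypothesis is
  WEAKER, so §2 supersedes file 3's reduction), `rest3_of_noOddWitness_of_localTorsionNeZero` (REST‴
  splits into the two honest atoms **(α) no odd non-split (ram) witness** — every `E[p]`-ramified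
  multiplicative `q ≠ p` split, or only `q = 2` non-split — and **(β) `E(ℚ_p)[p] ≠ 0`**, which at a
  multiplicative `p ≥ 3` forces `p` SPLIT with `p ∣ v_p(Δ_min)` and `p ∣ c_p`
  (`LocalTorsion.split_and_dvd_of_localTorsion_ne_zero`), so (β) lies off the Locus), and the converse
  `rest3_of_openInputRamOffErratumLocus` (REST‴ ⇐ child 19274 + g0's child R: nothing lost).

CENSUS (DATA, zero-compute fold of multr1-p1 `census2_all_500k.tsv.gz`, X11b shape, `p ≥ 5`,
`N < 5·10⁵`, class-wide pairs; this seat, session g3): (ram) = 2 155 109; REST″ ∩ (ram) = 722 875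
(file 3); **REST‴ ∩ (ram) = 703 204** = (α) 700 633 [every ramified witness split 548 970 + only
`q = 2` non-split 151 663] + (β) with an odd witness 2 571 [966 of them semistable]; newly discharged
vs file 3: 19 671 pairs (the off-Locus NON-semistable rows with an odd witness and (iv)).
CONDITIONAL; nothing booked; closes rung K2 of BirchSwinnertonDyer for NO pair by itself.

References: [Castella2018Erratum] Thm. 1.1 (i)–(iv), (2.4), Thm. A′ (pp. 1, 4); [Castella2018]
Thms. 3.1–3.2, §5 (arXiv:1704.06608); [JetchevSkinnerWan2017] Thm. 3.3.1, Prop. 3.2.1, §3.5 (3.5.c),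
§7.4.1; [Wuthrich2014] Prop. 21 (p. 400); [SilvermanATAEC1994] Cor. IV.9.2; [Miller2011LMS] Def. 1.1.
-/

set_option autoImplicit false
set_option linter.dupNamespace false

noncomputable section

open scoped Classical

open WeierstrassCurve NumberField IsDedekindDomain Field
open Literature.NumberTheory.EllipticCurves Literature.NumberTheory.EllipticCurves.GreenbergSelmer
open Literature.NumberTheory.EllipticCurves.ModularForms
open Literature.NumberTheory.EllipticCurves.Rank1Residual
open Literature.NumberTheory.EllipticCurves.Rank1Residual.Typed
open Literature.NumberTheory.EllipticCurves.Wuthrich2014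
open Literature.NumberTheory.EllipticCurves.Castella2018
open Literature.NumberTheory.EllipticCurves.JetchevSkinnerWan2017
open Literature.NumberTheory.GaloisRepresentations
open Literature.NumberTheory.GaloisCohomology
open Summit.BirchSwinnertonDyer.Rank1Residual Summit.BirchSwinnertonDyer.Rank1Residual.X11b
open Summit.BirchSwinnertonDyer.BirchSwinnertonDyer.Theses

namespace Summit.BirchSwinnertonDyer.BirchSwinnertonDyer.Theorems

/-! ### §1 Pair level, any conductor: odd non-split (ram) witness + (iv), from H2 ∧ H3♭ -/

section Pair

variable (W : WeierstrassCurve ℚ) [W.IsElliptic] [W.IsGloballyMinimal] (p : ℕ) [Fact p.Prime]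

/-- **ANY conductor, on or off the Locus: an odd non-split (ram) witness and (iv) suffice, from H2 ∧
H3♭ — no second prime, no semistability.** For a globally minimal elliptic `W/ℚ`, a prime `p`, an ODD
non-split multiplicative `q ≠ p` with `p ∤ v_q(Δ_min)` and the local-torsion clause (iv)
`E(ℚ_p)[p] = 0` (erratum Thm. 1.1 (iv)): H2 = `R1.BDPValueCoreFrameOnTree W p` ∧ H3♭ =
`P2.IMCDivIntCoreFrameAtErratumData W p` + `hGZ86 hGZK hWu hSk hnf hCST hFH hMaz hGZ hKo` + the
Jetchev–Skinner–Wan control fact `h331` + the cited `hPTs hEP` ⟹ `P2OpenInputOnTreeAt W p`. Lower half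
by file 1's `missingLowerBoundAt_of_erratumHypotheses_of_coreFrames`; control at the classical data by
`p2ControlOnTreeAt_of_thm331Mult` (every pair); open input by file 1's one-sided tightness
`openInputOnTreeAt_of_missingLowerBoundAt_of_ram`. This is file 3's
`openInputOnTreeAt_of_oddNonsplitRam_of_semistable_of_coreFrames` with `hss : Semistable W` and
`h23` REMOVED. CONDITIONAL on H2, H3♭ and the named facts; nothing booked.
[cite: Castella2018Erratum, Thm. 1.1, (2.4) (pp. 1, 4)] [cite: Castella2018, §5 (p. 12) (arXiv:1704.06608)]
[cite: JetchevSkinnerWan2017, Thm. 3.3.1 with §3.5 (3.5.c) (arXiv:1512.06894 pp. 11, 15)]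
[cite: Wuthrich2014, Prop. 21 (p. 400)] [cite: Miller2011LMS, Def. 1.1] -/
theorem openInputOnTreeAt_of_oddNonsplitRam_of_localTorsion_of_coreFrames
    (hGZ86 : GrossZagier1986_thm_I_7_3) (hGZK : rank_eq_analyticRank_of_analyticRank_le_one)
    (hWu : sha_dvd_analyticSha) (hSk : Skinner2016.thmC_padicValRat_bsd_rank_zero)
    (hnf : exists_isNewformOf) (hCST : CaiShuTian2014.thm11_trivialChar)
    (hFH : friedbergHoffstein_exists_twist_ne_zero_ramifiedAt)
    (hMaz : mazur_not_dvd_maninConstant_of_odd) (h331 : thm331_anticyclotomicControl_mult)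
    (hGZ : ∀ (N : ℕ) [NeZero N] (W : WeierstrassCurve ℚ) (K : Type) [Field K] [NumberField K],
      gross_zagier N W K)
    (hKo : ∀ (N : ℕ) [NeZero N] (W : WeierstrassCurve ℚ) (K : Type) [Field K] [NumberField K],
      kolyvagin N W K)
    (hPTs : ∀ (K : Type) [Field K] [NumberField K], poitouTate_sum_localTatePairing_eq_zero K)
    (hEP : ∀ (K : Type) [Field K] [NumberField K] (v : HeightOneSpectrum (𝓞 K)),
      localEulerPoincareCharacteristic (v.adicCompletion K))
    (h2 : R1.BDPValueCoreFrameOnTree W p) (h3 : P2.IMCDivIntCoreFrameAtErratumData W p)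
    {q : ℕ} [Fact q.Prime] (hq2 : q ≠ 2) (hqp : q ≠ p) (hmq : Mult W q)
    (hnsq : ¬ W.HasSplitMultiplicativeReductionAtPrime q)
    (hvq : ¬ p ∣ padicValInt q W.minimalDiscriminantInt)
    (htors : ∀ P : (W.baseChange ℚ_[p]).toAffine.Point, p • P = 0 → P = 0) :
    P2OpenInputOnTreeAt W p := by
  refine p2OpenInputOnTreeAt_of_imp_surj W p fun hX hp5 _hs ↦ ?_
  have hr : W.analyticRank = 1 := hX.1
  have hram : Ram W p := ⟨q, ‹_›, hqp, hmq, hvq⟩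
  have hE : ErratumHypotheses W p := ⟨hp5, hX.2.2.1, hX.2.2.2, ⟨q, ‹_›, hqp, hmq, hnsq, hvq⟩, htors⟩
  have hlow : Typed.MissingLowerBoundAt W p :=
    missingLowerBoundAt_of_erratumHypotheses_of_coreFrames W p hGZ86 hGZK hWu hnf hCST hFH hMaz hPTs
      hEP h2 h3 hE hq2 hqp hmq hnsq hvq hr
  exact openInputOnTreeAt_of_missingLowerBoundAt_of_ram W p hGZ hKo hSk hGZK
    (hasEntireLFunction_rat_of_exists_isNewformOf hnf)
    (p2ControlOnTreeAt_of_thm331Mult W p h331 hKo) hram hlow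

/-- **§1b — on the Locus `p ∤ ∏c`, (iv) is a theorem**: the same conclusion from the odd non-split
(ram) witness and `p ∤ ∏_ℓ c_ℓ(E)` (any conductor), the clause (iv) being discharged INSIDE the crux
(where `p ≥ 5` is multiplicative) by
`LocalTorsion.localTorsion_eq_zero_of_not_dvd_tamagawaProduct`. Compare file 2's
`openInputOnTreeAt_of_oddNonsplitRam_of_not_dvd_of_coreFrames` (control from the Poitou–Tate atoms
`hPT hPT2 hcd` on the Locus): here control is by citation, so those three inputs drop.
CONDITIONAL on H2, H3♭ and the named facts; nothing booked.
[cite: Castella2018Erratum, Thm. 1.1 (iv) and Remark (pp. 1–2)] [cite: SilvermanATAEC1994, Cor. IV.9.2(d) with (b) (PDF p. 340)]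
[cite: JetchevSkinnerWan2017, Thm. 3.3.1 with §3.5 (3.5.c) (arXiv:1512.06894 pp. 11, 15)] -/
theorem openInputOnTreeAt_of_oddNonsplitRam_of_not_dvd_of_coreFrames_of_thm331Mult
    (hGZ86 : GrossZagier1986_thm_I_7_3) (hGZK : rank_eq_analyticRank_of_analyticRank_le_one)
    (hWu : sha_dvd_analyticSha) (hSk : Skinner2016.thmC_padicValRat_bsd_rank_zero)
    (hnf : exists_isNewformOf) (hCST : CaiShuTian2014.thm11_trivialChar)
    (hFH : friedbergHoffstein_exists_twist_ne_zero_ramifiedAt)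
    (hMaz : mazur_not_dvd_maninConstant_of_odd) (h331 : thm331_anticyclotomicControl_mult)
    (hGZ : ∀ (N : ℕ) [NeZero N] (W : WeierstrassCurve ℚ) (K : Type) [Field K] [NumberField K],
      gross_zagier N W K)
    (hKo : ∀ (N : ℕ) [NeZero N] (W : WeierstrassCurve ℚ) (K : Type) [Field K] [NumberField K],
      kolyvagin N W K)
    (hPTs : ∀ (K : Type) [Field K] [NumberField K], poitouTate_sum_localTatePairing_eq_zero K)
    (hEP : ∀ (K : Type) [Field K] [NumberField K] (v : HeightOneSpectrum (𝓞 K)),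
      localEulerPoincareCharacteristic (v.adicCompletion K))
    (h2 : R1.BDPValueCoreFrameOnTree W p) (h3 : P2.IMCDivIntCoreFrameAtErratumData W p)
    {q : ℕ} [Fact q.Prime] (hq2 : q ≠ 2) (hqp : q ≠ p) (hmq : Mult W q)
    (hnsq : ¬ W.HasSplitMultiplicativeReductionAtPrime q)
    (hvq : ¬ p ∣ padicValInt q W.minimalDiscriminantInt) (htam : ¬ p ∣ W.tamagawaProduct) :
    P2OpenInputOnTreeAt W p := by
  refine p2OpenInputOnTreeAt_of_imp_surj W p fun hX hp5 _hs ↦ ?_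
  exact openInputOnTreeAt_of_oddNonsplitRam_of_localTorsion_of_coreFrames W p hGZ86 hGZK hWu hSk hnf
    hCST hFH hMaz h331 hGZ hKo hPTs hEP h2 h3 hq2 hqp hmq hnsq hvq
    (LocalTorsion.localTorsion_eq_zero_of_not_dvd_tamagawaProduct W p (by omega) hX.2.2.1 htam)

end Pair

/-! ### §2 The child `OpenInputRamOffErratumLocus` (19274) from its siblings and the residual REST‴ -/

section Child

/-- **Glue: the (ram) residual child from the pair-level theorem's locus and REST‴.** If the open input
holds at every pair with an odd non-split (ram) witness and (iv), and on the (ram) pairs outside that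
locus (REST‴), then it holds on all of child 19274's rows (indeed on every (ram) pair). Bookkeeping
only. [folklore] -/
theorem openInputRamOffErratumLocus_of_oddNonsplitRam_localTorsion_of_rest3
    (hM : ∀ (W : WeierstrassCurve ℚ) [W.IsElliptic] [W.IsGloballyMinimal] (p : ℕ) [Fact p.Prime],
      (∃ (q : ℕ) (_ : Fact q.Prime), q ≠ 2 ∧ q ≠ p ∧ Mult W q ∧
        ¬ W.HasSplitMultiplicativeReductionAtPrime q ∧ ¬ p ∣ padicValInt q W.minimalDiscriminantInt) →
      (∀ P : (W.baseChange ℚ_[p]).toAffine.Point, p • P = 0 → P = 0) → P2OpenInputOnTreeAt W p)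
    (hrest : ∀ (W : WeierstrassCurve ℚ) [W.IsElliptic] [W.IsGloballyMinimal] (p : ℕ) [Fact p.Prime],
      Ram W p →
      ¬ ((∃ (q : ℕ) (_ : Fact q.Prime), q ≠ 2 ∧ q ≠ p ∧ Mult W q ∧
            ¬ W.HasSplitMultiplicativeReductionAtPrime q ∧
            ¬ p ∣ padicValInt q W.minimalDiscriminantInt) ∧
          (∀ P : (W.baseChange ℚ_[p]).toAffine.Point, p • P = 0 → P = 0)) →
      P2OpenInputOnTreeAt W p) :
    ErratumRoadFive.OpenInputRamOffErratumLocus := by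
  unfold ErratumRoadFive.OpenInputRamOffErratumLocus
  intro W _ _ p _ hram _
  by_cases h : (∃ (q : ℕ) (_ : Fact q.Prime), q ≠ 2 ∧ q ≠ p ∧ Mult W q ∧
      ¬ W.HasSplitMultiplicativeReductionAtPrime q ∧ ¬ p ∣ padicValInt q W.minimalDiscriminantInt) ∧
    (∀ P : (W.baseChange ℚ_[p]).toAffine.Point, p • P = 0 → P = 0)
  · exact hM W p h.1 h.2
  · exact hrest W p hram h

/-- **CHILD 19274 FROM ITS SIBLINGS AND THE RESIDUAL REST‴ (the reduction of record, session g3;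
supersedes file 3's `openInputRamOffErratumLocus_of_children_of_rest`).** `IMCDivAtErratumDataAll`
(item 19270: H3♭ at every pair) → `BDPValueCoreFramesAll` (item 19275: H2 at every pair) →
`PublishedInputsIMCReduction` (item 19283) → `sha_dvd_analyticSha` (Wuthrich 2014 Prop. 21, PUBLISHED;
= support item 19285 by `rfl`) → `thm331_anticyclotomicControl_mult` (Jetchev–Skinner–Wan 2017
Thm. 3.3.1 + (3.5.c) at a multiplicative `p`, PUBLISHED, any conductor — replacing Cas18 Thm. 2.3 and
its "semistable") → REST‴ → `OpenInputRamOffErratumLocus`. REST‴ = the open input on the (ram) pairs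
that LACK an odd non-split `E[p]`-ramified multiplicative `q ≠ p` together with (iv) `E(ℚ_p)[p] = 0`:
(α) every ramified multiplicative witness split (548 970 cw pairs) or only `q = 2` non-split
(151 663), (β) `E(ℚ_p)[p] ≠ 0` with an odd witness (2 571) — 703 204 of the (ram) atom's 2 155 109
(census fold, `N < 5·10⁵`); NO semistability and NO Locus condition remain. CONDITIONAL on the
sibling items and the named facts; nothing booked; no pair closed by this.
[cite: Castella2018Erratum, Thm. 1.1, (2.4), Thm. A′ (pp. 1, 4)] [cite: Wuthrich2014, Prop. 21 (p. 400)]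
[cite: JetchevSkinnerWan2017, Thm. 3.3.1, Prop. 3.2.1, §3.5 (3.5.c) (arXiv:1512.06894 pp. 9–11, 15)]
[cite: Castella2018, Thms. 3.1–3.2 (p. 9), §5 (p. 12) (arXiv:1704.06608)] [cite: Miller2011LMS, Def. 1.1] -/
theorem openInputRamOffErratumLocus_of_children_of_rest3
    (h3 : ErratumRoadFive.IMCDivAtErratumDataAll) (h2 : ErratumRoadFive.BDPValueCoreFramesAll)
    (hF : ErratumRoadFive.PublishedInputsIMCReduction)
    (hWu : sha_dvd_analyticSha) (h331 : thm331_anticyclotomicControl_mult)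
    (hrest : ∀ (W : WeierstrassCurve ℚ) [W.IsElliptic] [W.IsGloballyMinimal] (p : ℕ) [Fact p.Prime],
      Ram W p →
      ¬ ((∃ (q : ℕ) (_ : Fact q.Prime), q ≠ 2 ∧ q ≠ p ∧ Mult W q ∧
            ¬ W.HasSplitMultiplicativeReductionAtPrime q ∧
            ¬ p ∣ padicValInt q W.minimalDiscriminantInt) ∧
          (∀ P : (W.baseChange ℚ_[p]).toAffine.Point, p • P = 0 → P = 0)) →
      P2OpenInputOnTreeAt W p) :
    ErratumRoadFive.OpenInputRamOffErratumLocus := by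
  unfold ErratumRoadFive.IMCDivAtErratumDataAll at h3
  unfold ErratumRoadFive.BDPValueCoreFramesAll at h2
  obtain ⟨hGZ86, hGZK, hSk, hnf, hCST, hFH, hMaz, hGZ, hKo, -, -, hPTs, -, -, hEP, -⟩ := hF
  refine openInputRamOffErratumLocus_of_oddNonsplitRam_localTorsion_of_rest3
    (fun W _ _ p _ hq htors ↦ ?_) hrest
  obtain ⟨q, _, hq2, hqp, hmq, hnsq, hvq⟩ := hq
  exact openInputOnTreeAt_of_oddNonsplitRam_of_localTorsion_of_coreFrames W p hGZ86 hGZK hWu hSk hnf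
    hCST hFH hMaz h331 hGZ hKo hPTs hEP (h2 W p) (h3 W p) hq2 hqp hmq hnsq hvq htors

/-- **The same with H3♭ supplied BY CITATION** from the typed erratum FACT (Castella erratum Thm. 1.1 =
arXiv:2409.01360 Thm. 3.1, OPEN, p417695; g0's bridge `imcDivIntCoreFrameAtErratumData_of_erratumThm11_OPEN`):
modulo the OPEN fact, the sibling `BDPValueCoreFramesAll` (H2), the facts items 19283 ∕ 19285 and the
JSW control fact, child 19274 SHRINKS to REST‴. This is the director's row «erratum Thm. 1.1 (⇐ FW21
Thm. 4.41) ⟹ `P2OpenInputOnTreeAt W p` on (ram) ∧ ρ̄ onto, p ≥ 5» in kernel form, on the full reach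
of the erratum's hypotheses (i)–(iv) as typed (odd ramified `q`: Cas20's odd-`d_K` standing binder).
CONDITIONAL; nothing booked; no pair closed by this. [claim: Castella2018Erratum, status: under-review]
[cite: Wuthrich2014, Prop. 21 (p. 400)] [cite: JetchevSkinnerWan2017, Thm. 3.3.1 with §3.5 (3.5.c) (arXiv:1512.06894 pp. 11, 15)]
[cite: Miller2011LMS, Def. 1.1] -/
theorem openInputRamOffErratumLocus_of_erratumThm11_OPEN_of_bdpValueCoreFrames_of_rest3
    (h11 : erratumThm11_exists_isBDPLFunction_isTorsion_charIdeal_eq_OPEN)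
    (h2 : ErratumRoadFive.BDPValueCoreFramesAll) (hF : ErratumRoadFive.PublishedInputsIMCReduction)
    (hWu : sha_dvd_analyticSha) (h331 : thm331_anticyclotomicControl_mult)
    (hrest : ∀ (W : WeierstrassCurve ℚ) [W.IsElliptic] [W.IsGloballyMinimal] (p : ℕ) [Fact p.Prime],
      Ram W p →
      ¬ ((∃ (q : ℕ) (_ : Fact q.Prime), q ≠ 2 ∧ q ≠ p ∧ Mult W q ∧
            ¬ W.HasSplitMultiplicativeReductionAtPrime q ∧
            ¬ p ∣ padicValInt q W.minimalDiscriminantInt) ∧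
          (∀ P : (W.baseChange ℚ_[p]).toAffine.Point, p • P = 0 → P = 0)) →
      P2OpenInputOnTreeAt W p) :
    ErratumRoadFive.OpenInputRamOffErratumLocus :=
  openInputRamOffErratumLocus_of_children_of_rest3
    (by
      unfold ErratumRoadFive.IMCDivAtErratumDataAll
      exact fun W _ _ p _ ↦
        imcDivIntCoreFrameAtErratumData_of_erratumThm11_OPEN (W := W) (p := p) h11)
    h2 hF hWu h331 hrest

end Child

/-! ### §3 Bookkeeping: REST‴ versus REST″, the two atoms of REST‴, and the converse -/

section Bookkeeping

/-- **REST″ ⟹ REST‴ — the new residual hypothesis is WEAKER** (so §2 supersedes file 3's reduction):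
a (ram) pair outside {odd witness ∧ (iv)} is outside {odd witness ∧ (Locus ∨ (Semistable ∧ (iv)))},
because on the Locus `p ∤ ∏c` the clause (iv) holds at the crux's pairs (`p ≥ 5` multiplicative;
`LocalTorsion.localTorsion_eq_zero_of_not_dvd_tamagawaProduct`). Bookkeeping only.
[cite: SilvermanATAEC1994, Cor. IV.9.2(d) with (b) (PDF p. 340)] -/
theorem rest3_of_rest2
    (hrest : ∀ (W : WeierstrassCurve ℚ) [W.IsElliptic] [W.IsGloballyMinimal] (p : ℕ) [Fact p.Prime],
      Ram W p →
      ¬ ((∃ (q : ℕ) (_ : Fact q.Prime), q ≠ 2 ∧ q ≠ p ∧ Mult W q ∧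
            ¬ W.HasSplitMultiplicativeReductionAtPrime q ∧
            ¬ p ∣ padicValInt q W.minimalDiscriminantInt) ∧
          (¬ p ∣ W.tamagawaProduct ∨
            (Semistable W ∧ ∀ P : (W.baseChange ℚ_[p]).toAffine.Point, p • P = 0 → P = 0))) →
      P2OpenInputOnTreeAt W p) :
    ∀ (W : WeierstrassCurve ℚ) [W.IsElliptic] [W.IsGloballyMinimal] (p : ℕ) [Fact p.Prime],
      Ram W p →
      ¬ ((∃ (q : ℕ) (_ : Fact q.Prime), q ≠ 2 ∧ q ≠ p ∧ Mult W q ∧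
            ¬ W.HasSplitMultiplicativeReductionAtPrime q ∧
            ¬ p ∣ padicValInt q W.minimalDiscriminantInt) ∧
          (∀ P : (W.baseChange ℚ_[p]).toAffine.Point, p • P = 0 → P = 0)) →
      P2OpenInputOnTreeAt W p := by
  intro W _ _ p _ hram h
  refine p2OpenInputOnTreeAt_of_imp_surj W p fun hX hp5 _hs ↦ hrest W p hram ?_
  rintro ⟨hq, htam | ⟨-, htors⟩⟩
  · exact h ⟨hq, LocalTorsion.localTorsion_eq_zero_of_not_dvd_tamagawaProduct W p (by omega)
      hX.2.2.1 htam⟩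
  · exact h ⟨hq, htors⟩

/-- **REST‴ from its two honest atoms.** (α) the (ram) pairs with NO odd non-split `E[p]`-ramified
multiplicative `q ≠ p` (every ramified witness split, or only `q = 2` non-split — outside the erratum's
hypothesis (iii) with Cas20's odd `d_K`), and (β) the (ram) pairs with a non-zero `p`-torsion point in
`E(ℚ_p)` (erratum hypothesis (iv) fails; by `LocalTorsion.split_and_dvd_of_localTorsion_ne_zero`
this forces `p` SPLIT multiplicative with `p ∣ v_p(Δ_min)` and `p ∣ c_p`, in particular OFF the Locus), together give
REST‴. The planner's re-split of child 19274: {§1's locus, dischargeable now modulo 19270 + 19275 +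
19283 + 19285 + the JSW fact} + (α) + (β). Bookkeeping only. [folklore]
[cite: Castella2018Erratum, Thm. 1.1 (iii)–(iv) (p. 1)] -/
theorem rest3_of_noOddWitness_of_localTorsionNeZero
    (hα : ∀ (W : WeierstrassCurve ℚ) [W.IsElliptic] [W.IsGloballyMinimal] (p : ℕ) [Fact p.Prime],
      Ram W p →
      (∀ (q : ℕ) [Fact q.Prime], q ≠ 2 → q ≠ p → Mult W q →
        ¬ W.HasSplitMultiplicativeReductionAtPrime q → p ∣ padicValInt q W.minimalDiscriminantInt) →
      P2OpenInputOnTreeAt W p)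
    (hβ : ∀ (W : WeierstrassCurve ℚ) [W.IsElliptic] [W.IsGloballyMinimal] (p : ℕ) [Fact p.Prime],
      Ram W p → W.HasSplitMultiplicativeReductionAtPrime p →
      p ∣ padicValInt p W.minimalDiscriminantInt →
      p ∣ (W.baseChange ℚ_[p]).localTamagawaNumber ℤ_[p] →
      (∃ P : (W.baseChange ℚ_[p]).toAffine.Point, p • P = 0 ∧ P ≠ 0) → P2OpenInputOnTreeAt W p) :
    ∀ (W : WeierstrassCurve ℚ) [W.IsElliptic] [W.IsGloballyMinimal] (p : ℕ) [Fact p.Prime],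
      Ram W p →
      ¬ ((∃ (q : ℕ) (_ : Fact q.Prime), q ≠ 2 ∧ q ≠ p ∧ Mult W q ∧
            ¬ W.HasSplitMultiplicativeReductionAtPrime q ∧
            ¬ p ∣ padicValInt q W.minimalDiscriminantInt) ∧
          (∀ P : (W.baseChange ℚ_[p]).toAffine.Point, p • P = 0 → P = 0)) →
      P2OpenInputOnTreeAt W p := by
  intro W _ _ p _ hram h
  refine p2OpenInputOnTreeAt_of_imp_surj W p fun hX hp5 _hs ↦ ?_
  by_cases htors : ∀ P : (W.baseChange ℚ_[p]).toAffine.Point, p • P = 0 → P = 0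
  · -- (α): no odd witness
    refine hα W p hram fun q _ hq2 hqp hmq hnsq ↦ ?_
    by_contra hvq
    exact h ⟨⟨q, ‹_›, hq2, hqp, hmq, hnsq, hvq⟩, htors⟩
  · -- (β): a non-zero `p`-torsion point
    push Not at htors
    obtain ⟨P, hP, hne⟩ := htors
    obtain ⟨hs, hv, hc, -⟩ :=
      LocalTorsion.split_and_dvd_of_localTorsion_ne_zero W p (by omega) hX.2.2.1 P hP hne
    exact hβ W p hram hs hv hc ⟨P, hP, hne⟩

/-- **Nothing lost: REST‴ follows from child 19274 together with g0's child R** (`R1Population ∩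
Locus`) — via file 3's `rest_of_openInputRamOffErratumLocus` and `rest3_of_rest2`. Bookkeeping only.
[folklore] -/
theorem rest3_of_openInputRamOffErratumLocus (hRam : ErratumRoadFive.OpenInputRamOffErratumLocus)
    (hR : ∀ (W : WeierstrassCurve ℚ) [W.IsElliptic] [W.IsGloballyMinimal] (p : ℕ) [Fact p.Prime],
      R1Population W p → ¬ p ∣ W.tamagawaProduct → P2OpenInputOnTreeAt W p) :
    ∀ (W : WeierstrassCurve ℚ) [W.IsElliptic] [W.IsGloballyMinimal] (p : ℕ) [Fact p.Prime],
      Ram W p →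
      ¬ ((∃ (q : ℕ) (_ : Fact q.Prime), q ≠ 2 ∧ q ≠ p ∧ Mult W q ∧
            ¬ W.HasSplitMultiplicativeReductionAtPrime q ∧
            ¬ p ∣ padicValInt q W.minimalDiscriminantInt) ∧
          (∀ P : (W.baseChange ℚ_[p]).toAffine.Point, p • P = 0 → P = 0)) →
      P2OpenInputOnTreeAt W p :=
  rest3_of_rest2 (rest_of_openInputRamOffErratumLocus hRam hR)

end Bookkeeping

end Summit.BirchSwinnertonDyer.BirchSwinnertonDyer.Theorems

end
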